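import Mathlib
import Literature.NumberTheory.Transcendental.KZCalculus

/-!
# Route FermatIsogeny, crux `BetaProductSector` (stmt-KontsevichZagierPeriods-3898) — posited objects of line
# `registered` v3 (lead c3, 2026-08-17): Hodge terms, the Γ-divisor criterion for UNIFORM 2-word moves, steps

Objects (all real definitions, no named facts) used by the reshaped skeleton of the crux and by its stubs:

* `hodgeTerm a b u = {ua} + {ub} − {u(a+b)}` (`{·} = Int.fract`), the Deligne–Koblitz–Ogus Hodge term of the
  Beta atom `B(a,b)` at the unit `u`; `HodgeEqAtoms`, `HodgeEqWords` (equality of Hodge functions at every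
  `u ≥ 1` coprime to the denominators — the weight-`0` Hodge-type condition, as in the split child
  `BetaProductHodgeType` of the crux).
* The Γ-DIVISOR CRITERION for one-parameter families. A (2,2) move in a family is a pair of words
  `((x₁+n₁t, y₁+n₂t),(x₂+n₃t, y₂+n₄t))`, `((x₃+n₅t, y₃+n₆t),(x₄+n₇t, y₄+n₈t))` (rational base point, integer
  slopes). Its Γ-quotient `F(t)` has the twelve factors `Γ(x₁+n₁t), Γ(y₁+n₂t), Γ(x₁+y₁+(n₁+n₂)t)⁻¹, …`. Expanding
  every `Γ(α + m t)` by Gauss's multiplication formula of order `|m|` (after Euler's reflection when `m < 0`)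
  writes `F(t) = (slope-0 factors) · (elementary) · Π_k Γ(t + β_k)^{±1}`; `F` is elementary in `t` iff the
  signed multiset of the `β_k mod 1` cancels — `moveDivisor … = 0` (`divisorTerm`) — and the move is FULLY
  UNIFORM when moreover the slope-`0` factors pair off by translation (`Γ(α+1) = αΓ(α)`) and reflection
  (`Γ(α)Γ(1−α) = π / sin πα`) up to factors `Γ(k)`, `Γ(k + ½)` — `moveConst … = 0` (`constTerm`). Examples:
  Dirichlet re-association `B(a,b)B(a+b,k) = B(a,b+k)B(b,k)`, the quadratic move
  `B(x,y)B(x+½,y) = 2^{2y}B(2x,2y)B(y,y)`, the two-duplication move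
  `B(u,u+4p)B(p,½−3p−u) = 4^{1−u−3p}cos(π(u+2p))·B(u,2p)B(u+4p,½−3p−u)`, the order-5 move
  `B(x,y)B(x,y+⅕) = c·B(x,5y)B(x,3y+⅕)` (`x = ⅕ − 2y`).
* `IsPinned a b e d c r`: the representation `r` is the box `(0,1)²` with integrand
  `c · x^{a-1}(1-x)^{b-1} y^{e-1}(1-y)^{d-1}` (the pinning used verbatim by the crux).
* The STEP relation of the chain normal form: `LinStep` (replace the first atom by a Hodge-equal atom), `SwapStep`,
  `UniformStep` (a fully uniform move whose value identity at the base point holds with an algebraic constant),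
  `Step = LinStep ∨ SwapStep ∨ UniformStep`.

References: P. Deligne, *Hodge cycles on abelian varieties*, LNM 900 (1982) §7 [Deligne1982HodgeCycles];
G. Andrews, R. Askey, R. Roy, *Special Functions* (1999) Thms 1.5.1, 1.5.2, 1.8.1 [AndrewsAskeyRoy1999];
M. Kontsevich, D. Zagier, *Periods* (2001) §1 [KontsevichZagier2001].
-/

noncomputable section

namespace Summit.KontsevichZagierPeriods.FermatIsogeny.BetaProductSectorDefs

open Literature.NumberTheory.Transcendental

/-! ## Hodge terms -/

/-- The Hodge term `{ua} + {ub} − {u(a+b)} ∈ {0,1}` of the Beta atom `B(a,b)` at the unit `u`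
(Deligne–Koblitz–Ogus). [cite: Deligne1982HodgeCycles, §7 (restatement before Thm. 7.18)] -/
def hodgeTerm (a b : ℚ) (u : ℕ) : ℚ :=
  Int.fract ((u : ℚ) * a) + Int.fract ((u : ℚ) * b) - Int.fract ((u : ℚ) * (a + b))

/-- Two Beta atoms have the same Hodge function: `hodgeTerm a₁ b₁ u = hodgeTerm a₂ b₂ u` for every `u ≥ 1`
coprime to the four denominators. [cite: Deligne1982HodgeCycles, §7 (restatement before Thm. 7.18)] -/
def HodgeEqAtoms (a₁ b₁ a₂ b₂ : ℚ) : Prop :=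
  ∀ u : ℕ, 0 < u → Nat.Coprime u a₁.den → Nat.Coprime u b₁.den → Nat.Coprime u a₂.den → Nat.Coprime u b₂.den →
    hodgeTerm a₁ b₁ u = hodgeTerm a₂ b₂ u

/-- Two (2,2) Beta words `((a,b),(e,d))`, `((a',b'),(e',d'))` have the same weight-`0` Hodge function (the
hypothesis of the split child `BetaProductHodgeSector`, conclusion of `BetaProductHodgeType`).
[cite: Deligne1982HodgeCycles, §7 (restatement before Thm. 7.18)] -/
def HodgeEqWords (a b e d a' b' e' d' : ℚ) : Prop :=
  ∀ u : ℕ, 0 < u → Nat.Coprime u a.den → Nat.Coprime u b.den → Nat.Coprime u e.den → Nat.Coprime u d.den →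
    Nat.Coprime u a'.den → Nat.Coprime u b'.den → Nat.Coprime u e'.den → Nat.Coprime u d'.den →
    hodgeTerm a b u + hodgeTerm e d u = hodgeTerm a' b' u + hodgeTerm e' d' u

/-! ## The Γ-divisor criterion for uniform moves -/

/-- Divisor term of the factor `Γ(α + m t)^e` (`e = ±1`): after Gauss multiplication of order `|m|` (and
reflection if `m < 0`) it contributes the unit-slope factors `Γ(t + β_j)^{e·sgn m}`,
`β_j = (sgn(m)·α + j)/|m|`, `j < |m|`; recorded as the signed multiset of the `β_j mod 1`.
[cite: AndrewsAskeyRoy1999, Thm 1.5.2] -/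
def divisorTerm (α : ℚ) (m e : ℤ) : ℚ →₀ ℤ :=
  if m = 0 then 0 else
    ∑ j ∈ Finset.range m.natAbs, Finsupp.single (Int.fract (((m.sign : ℚ) * α + j) / (m.natAbs : ℚ))) (e * m.sign)

/-- Constant term of the factor `Γ(α + m t)^e`: nothing unless `m = 0`; a slope-`0` factor `Γ(α)` is recorded
modulo translation and reflection as `+e·[{α}]` if `{α} < ½` and `−e·[1 − {α}]` if `{α} > ½` (`{α} ∈ {0, ½}`:
rational resp. rational·√π, dropped). [cite: AndrewsAskeyRoy1999, Thm 1.5.1] -/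
def constTerm (α : ℚ) (m e : ℤ) : ℚ →₀ ℤ :=
  if m ≠ 0 ∨ Int.fract α = 0 ∨ Int.fract α = 1 / 2 then 0 else
    if Int.fract α < 1 / 2 then Finsupp.single (Int.fract α) e else Finsupp.single (1 - Int.fract α) (-e)

/-- The Γ-divisor of the one-parameter move `((x₁+n₁t,y₁+n₂t),(x₂+n₃t,y₂+n₄t)) ~ ((x₃+n₅t,y₃+n₆t),(x₄+n₇t,y₄+n₈t))`:
the sum of the divisor terms of its twelve Γ-factors (numerators of the source word and denominators of the
target word with `e = +1`, the other six with `e = −1`). It vanishes iff `F(t)` is elementary in `t`.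
[cite: AndrewsAskeyRoy1999, Thm 1.5.2] -/
def moveDivisor (x₁ y₁ x₂ y₂ x₃ y₃ x₄ y₄ : ℚ) (n₁ n₂ n₃ n₄ n₅ n₆ n₇ n₈ : ℤ) : ℚ →₀ ℤ :=
  divisorTerm x₁ n₁ 1 + divisorTerm y₁ n₂ 1 + divisorTerm (x₁ + y₁) (n₁ + n₂) (-1) +
  divisorTerm x₂ n₃ 1 + divisorTerm y₂ n₄ 1 + divisorTerm (x₂ + y₂) (n₃ + n₄) (-1) +
  divisorTerm x₃ n₅ (-1) + divisorTerm y₃ n₆ (-1) + divisorTerm (x₃ + y₃) (n₅ + n₆) 1 +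
  divisorTerm x₄ n₇ (-1) + divisorTerm y₄ n₈ (-1) + divisorTerm (x₄ + y₄) (n₇ + n₈) 1

/-- The constant part of the move (slope-`0` factors modulo translation/reflection). [cite: AndrewsAskeyRoy1999, Thm 1.5.1] -/
def moveConst (x₁ y₁ x₂ y₂ x₃ y₃ x₄ y₄ : ℚ) (n₁ n₂ n₃ n₄ n₅ n₆ n₇ n₈ : ℤ) : ℚ →₀ ℤ :=
  constTerm x₁ n₁ 1 + constTerm y₁ n₂ 1 + constTerm (x₁ + y₁) (n₁ + n₂) (-1) +
  constTerm x₂ n₃ 1 + constTerm y₂ n₄ 1 + constTerm (x₂ + y₂) (n₃ + n₄) (-1) +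
  constTerm x₃ n₅ (-1) + constTerm y₃ n₆ (-1) + constTerm (x₃ + y₃) (n₅ + n₆) 1 +
  constTerm x₄ n₇ (-1) + constTerm y₄ n₈ (-1) + constTerm (x₄ + y₄) (n₇ + n₈) 1

/-- FULLY UNIFORM move: the Γ-quotient of the family is a formal consequence of Gauss multiplication (in `t`),
Euler reflection and translation — divisor and constant part both vanish. [cite: AndrewsAskeyRoy1999, Thm 1.5.2] -/
def IsFullyUniform (x₁ y₁ x₂ y₂ x₃ y₃ x₄ y₄ : ℚ) (n₁ n₂ n₃ n₄ n₅ n₆ n₇ n₈ : ℤ) : Prop :=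
  moveDivisor x₁ y₁ x₂ y₂ x₃ y₃ x₄ y₄ n₁ n₂ n₃ n₄ n₅ n₆ n₇ n₈ = 0 ∧
    moveConst x₁ y₁ x₂ y₂ x₃ y₃ x₄ y₄ n₁ n₂ n₃ n₄ n₅ n₆ n₇ n₈ = 0

/-! ## Pinned product representations and the step relation -/

/-- `r` is PINNED to the weighted word `((a,b),(e,d); c)`: domain the open box `(0,1)²`, integrand
`c · x^{a-1}(1-x)^{b-1} · y^{e-1}(1-y)^{d-1}` on it (the pinning of the crux `BetaProductSector`).
[cite: KontsevichZagier2001, §1.1] -/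
def IsPinned (a b e d : ℚ) (c : ℝ) (r : KZ.IntegralRep 2) : Prop :=
  r.domain = {x | ∀ i, x i ∈ Set.Ioo (0:ℝ) 1} ∧
    Set.EqOn r.integrand (fun x => c * (x 0) ^ ((a:ℝ) - 1) * (1 - x 0) ^ ((b:ℝ) - 1) *
      (x 1) ^ ((e:ℝ) - 1) * (1 - x 1) ^ ((d:ℝ) - 1)) r.domain

/-- LIN step: replace the first atom by a Hodge-equal atom (all entries positive). [cite: Deligne1982HodgeCycles, Thm. 7.18] -/
def LinStep (p p' : (ℚ × ℚ) × (ℚ × ℚ)) : Prop :=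
  ∃ a₁ b₁ a₂ b₂ e d : ℚ, 0 < a₁ ∧ 0 < b₁ ∧ 0 < a₂ ∧ 0 < b₂ ∧ 0 < e ∧ 0 < d ∧ HodgeEqAtoms a₁ b₁ a₂ b₂ ∧
    p = ((a₁, b₁), (e, d)) ∧ p' = ((a₂, b₂), (e, d))

/-- SWAP step: exchange the two atoms. [cite: KontsevichZagier2001, §1.2 rule (2)] -/
def SwapStep (p p' : (ℚ × ℚ) × (ℚ × ℚ)) : Prop :=
  ∃ a b e d : ℚ, p = ((a, b), (e, d)) ∧ p' = ((e, d), (a, b))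

/-- UNIFORM step: `p ~ p'` is the base point (`t = 0`) of a fully uniform one-parameter move whose value
identity `B(p) = c · B(p')` holds with `c` real algebraic (`B = ProbabilityTheory.beta`).
[cite: AndrewsAskeyRoy1999, Thm 1.5.2] -/
def UniformStep (p p' : (ℚ × ℚ) × (ℚ × ℚ)) : Prop :=
  ∃ (x₁ y₁ x₂ y₂ x₃ y₃ x₄ y₄ : ℚ) (n₁ n₂ n₃ n₄ n₅ n₆ n₇ n₈ : ℤ) (c : ℝ),
    0 < x₁ ∧ 0 < y₁ ∧ 0 < x₂ ∧ 0 < y₂ ∧ 0 < x₃ ∧ 0 < y₃ ∧ 0 < x₄ ∧ 0 < y₄ ∧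
    IsFullyUniform x₁ y₁ x₂ y₂ x₃ y₃ x₄ y₄ n₁ n₂ n₃ n₄ n₅ n₆ n₇ n₈ ∧ IsAlgebraic ℚ c ∧
    ProbabilityTheory.beta (x₁:ℝ) y₁ * ProbabilityTheory.beta (x₂:ℝ) y₂ =
      c * (ProbabilityTheory.beta (x₃:ℝ) y₃ * ProbabilityTheory.beta (x₄:ℝ) y₄) ∧
    p = ((x₁, y₁), (x₂, y₂)) ∧ p' = ((x₃, y₃), (x₄, y₄))

/-- The step relation of the length-2 chain normal form (line `registered` v3). [cite: KontsevichZagier2001, §1.2] -/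
def Step (p p' : (ℚ × ℚ) × (ℚ × ℚ)) : Prop :=
  LinStep p p' ∨ SwapStep p p' ∨ UniformStep p p'

end Summit.KontsevichZagierPeriods.FermatIsogeny.BetaProductSectorDefs

end
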